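import Summits.ValiantsHypothesis.ValiantsHypothesis.Theses.TwoAdicLadder
import Summits.ValiantsHypothesis.ValiantsHypothesis.Theorems.TwoAdicLadderCeilingAllPrecisions

/-!
# TwoAdicLadder — crux `TwoIntegralNormalisation` (stmt-ValiantsHypothesis-5947), line `birth`,
# stub `stub_halfElim`: THE OPEN KERNEL, AND THE PRECISION-BY-PRECISION FORM THAT HOLDS OUTRIGHT

Route `ValiantsHypothesis/TwoAdicLadder`, crux `TwoIntegralNormalisation` (TIN), registered line
`Cruxes/TwoIntegralNormalisation/Lines/birth.lean`, load-bearing open stub `stub_halfElim` (uniform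
elimination of division by `2` for the permanent: one `d` with
`L_{𝓞_(𝔭)}(per_n) ≤ (L_K(per_n) + n + 2)^d`). Census results of the stub prover (this seat):

* `halfElim_of_scaledPoly_of_polyDivision` — **the stub splits into two independent open pieces.**
  After denominator clearing (`scaledHalfElim`, file `…ScaledHalfElim.lean`: `2`-integral circuits
  for `2^M · per_n` at NO cost, `M` uncontrolled) the registered stub follows from
  (i) `ScaledHalfElimPoly` — the same with a POLYNOMIAL bound on the exponent `M` (constants of
  near-optimal circuits for `per_n` may be taken of polynomially bounded `2`-adic valuation), and
  (ii) `PolyDivision` — exact division by `2^M` over `𝓞_(𝔭)` at cost polynomial in `s + M + n`.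
  Both hypotheses are stated inline; the proof is exponent bookkeeping
  (`(B^e + B^e + B)^d ≤ B^((e+3)d)`, `B = s + n + 2 ≥ 2`).
* `precisionwise_normalisation` — **TIN with its quantifiers `∃ a ∀ k` swapped to `∀ k ∃ a` holds
  unconditionally and hypothesis-free**: for every precision `k` there is `a` with
  `L_R(per_n) ≤ n^a` eventually, `R = ℤ/2^(k+1)` admissible at precision `k` (tree
  `ceilingAllPrecisions_proof`: `per_n = Σ_{j<k+1} (−2)^j J_j`, `n^{O(k)}` determinants). So the
  whole content of the crux — and of `stub_halfElim` at finite precision — is the UNIFORMITY of the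
  exponent in `k` (the `2`-adic digit `j` of the permanent costs `n^{Θ(j)}` by the only known tool).

Honest framing: calibration/bookkeeping around an OPEN stub; `stub_halfElim`, the crux and VP ≠ VNP
are NOT proved here.
-/

noncomputable section

open MvPolynomial

-- the summit and the problem share the name `ValiantsHypothesis` (D-0017 single-conjunct layout)
set_option linter.dupNamespace false

namespace Summit.ValiantsHypothesis.ValiantsHypothesis.Theorems.TwoAdicLadder.TwoIntegralNormalisation

open Summit.ValiantsHypothesis.ValiantsHypothesis.Theses.TwoAdicLadder
open NumberField Literature.Computability.AlgebraicComplexity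

/-- Exponent bookkeeping: for `B ≥ 2`, `(B^e + B^e + B)^d ≤ B^((e+3)·d)`. [folklore] -/
theorem kernel_envelope (B e d : ℕ) (hB : 2 ≤ B) : (B ^ e + B ^ e + B) ^ d ≤ B ^ ((e + 3) * d) := by
  have h1 : B ^ e ≤ B ^ (e + 1) := Nat.pow_le_pow_right (by omega) (by omega)
  have h2 : B ≤ B ^ (e + 1) := by
    calc B = B ^ 1 := (pow_one B).symm
      _ ≤ B ^ (e + 1) := Nat.pow_le_pow_right (by omega) (by omega)
  have h3 : 3 ≤ B ^ 2 := by nlinarith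
  have h4 : B ^ e + B ^ e + B ≤ B ^ (e + 3) := by
    calc B ^ e + B ^ e + B ≤ 3 * B ^ (e + 1) := by omega
      _ ≤ B ^ 2 * B ^ (e + 1) := Nat.mul_le_mul_right _ h3
      _ = B ^ (e + 3) := by ring
  calc (B ^ e + B ^ e + B) ^ d ≤ (B ^ (e + 3)) ^ d := Nat.pow_le_pow_left h4 d
    _ = B ^ ((e + 3) * d) := (pow_mul B (e + 3) d).symm

/-- **The registered stub `stub_halfElim` follows from a polynomially bounded clearing exponent
plus polynomial-cost exact division by powers of `2`.** Hypothesis `hS` (`ScaledHalfElimPoly`):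
one exponent `e` such that `L_K(per_n) ≤ s` yields a number field `K'`, a prime `𝔭 ∋ 2` and
`M ≤ (s+n+2)^e` with `L_{𝓞_(𝔭)}(2^M · per_n) ≤ (s+n+2)^e` (the tree's `scaledHalfElim` gives this
WITHOUT the bound on `M`). Hypothesis `hD` (`PolyDivision`): one exponent `d` such that
`L_{𝓞_(𝔭)}(2^M · per_n) ≤ s` implies `L_{𝓞_(𝔭)}(per_n) ≤ (s + M + n + 2)^d`. Conclusion: the
registered signature of `stub_halfElim`, with exponent `(e+3)·d`. [folklore] -/
theorem halfElim_of_scaledPoly_of_polyDivision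
    (hS : ∃ e : ℕ, ∀ (n s : ℕ) (K : Type) [Field K] [NumberField K],
      complexity (perPoly (Fin n) K) ≤ s →
        ∃ (K' : Type) (_ : Field K') (_ : NumberField K')
          (P : Ideal (𝓞 K')) (_ : P.IsPrime), (2 : 𝓞 K') ∈ P ∧ ∃ M : ℕ, M ≤ (s + n + 2) ^ e ∧
          complexity (C ((2 : Localization.AtPrime P) ^ M) *
            perPoly (Fin n) (Localization.AtPrime P)) ≤ (s + n + 2) ^ e)
    (hD : ∃ d : ℕ, ∀ (n s M : ℕ) (K' : Type) [Field K'] [NumberField K']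
      (P : Ideal (𝓞 K')) [P.IsPrime], (2 : 𝓞 K') ∈ P →
        complexity (C ((2 : Localization.AtPrime P) ^ M) *
          perPoly (Fin n) (Localization.AtPrime P)) ≤ s →
        complexity (perPoly (Fin n) (Localization.AtPrime P)) ≤ (s + M + n + 2) ^ d) :
    ∃ d : ℕ, ∀ (n s : ℕ) (K : Type) [Field K] [NumberField K],
      complexity (perPoly (Fin n) K) ≤ s →
        ∃ (K' : Type) (_ : Field K') (_ : NumberField K')
          (P : Ideal (𝓞 K')) (_ : P.IsPrime),
          (2 : 𝓞 K') ∈ P ∧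
          complexity (perPoly (Fin n) (Localization.AtPrime P)) ≤ (s + n + 2) ^ d := by
  obtain ⟨e, he⟩ := hS
  obtain ⟨d, hd⟩ := hD
  refine ⟨(e + 3) * d, fun n s K _ _ hs => ?_⟩
  obtain ⟨K', _, _, P, hP, h2, M, hM, hle⟩ := he n s K hs
  refine ⟨K', inferInstance, inferInstance, P, hP, h2, ?_⟩
  have hdiv := hd n ((s + n + 2) ^ e) M K' P h2 hle
  refine hdiv.trans ?_
  have hB : 2 ≤ s + n + 2 := by omega
  calc ((s + n + 2) ^ e + M + n + 2) ^ d
      ≤ ((s + n + 2) ^ e + (s + n + 2) ^ e + (s + n + 2)) ^ d :=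
        Nat.pow_le_pow_left (by omega) d
    _ ≤ (s + n + 2) ^ ((e + 3) * d) := kernel_envelope (s + n + 2) e d hB

/-- `ℤ/2^(k+1)` is admissible at precision `k`: a finite commutative principal ideal ring with `2`
nilpotent and `2^k ≠ 0`. [folklore] -/
theorem zmod_two_pow_succ_admissible (k : ℕ) :
    IsPrincipalIdealRing (ZMod (2 ^ (k + 1))) ∧ IsNilpotent (2 : ZMod (2 ^ (k + 1))) ∧
      (2 : ZMod (2 ^ (k + 1))) ^ k ≠ 0 := by
  refine ⟨IsPrincipalIdealRing.of_surjective (Int.castRingHom (ZMod (2 ^ (k + 1))))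
    (ZMod.ringHom_surjective _), ⟨k + 1, ?_⟩, ?_⟩
  · have h := ZMod.natCast_self (2 ^ (k + 1))
    push_cast at h
    exact h
  · intro h
    have h' : ((2 ^ k : ℕ) : ZMod (2 ^ (k + 1))) = 0 := by push_cast; exact h
    rw [ZMod.natCast_eq_zero_iff] at h'
    have hlt : 2 ^ k < 2 ^ (k + 1) := Nat.pow_lt_pow_right (by norm_num) (by omega)
    exact absurd (Nat.le_of_dvd (Nat.pos_of_ne_zero (by positivity)) h') (not_le.2 hlt)

/-- **Precision by precision, the normalisation holds outright.** For every precision `k` there is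
an exponent `a` such that for all `n ≥ 2` some ring admissible at precision `k` (namely
`ℤ/2^(k+1)`) carries circuits of size `≤ n^a` for `per_n` — no hypothesis on `per` over `ℂ`, no
number field. This is the conclusion of `TwoIntegralNormalisation` with `∃ a ∀ k` weakened to
`∀ k ∃ a`; the crux (and `stub_halfElim` at finite precision) is exactly the uniformity of `a` in
`k`. Source of the circuits: tree `ceilingAllPrecisions_proof` (`per_n ≡ Σ_{j≤k} (−2)^j J_j`,
each `J_j` a sum of `n^{4j}` determinants). [folklore] -/
theorem precisionwise_normalisation (k : ℕ) :
    ∃ a : ℕ, ∀ᶠ n in Filter.atTop, ∃ (R : Type) (_ : CommRing R) (_ : Fintype R),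
      IsPrincipalIdealRing R ∧ IsNilpotent (2 : R) ∧ (2 : R) ^ k ≠ 0 ∧
      complexity (perPoly (Fin n) R) ≤ n ^ a := by
  obtain ⟨c, hc⟩ := ceilingAllPrecisions_proof (k + 1)
  obtain ⟨hPIR, hnil, hne⟩ := zmod_two_pow_succ_admissible k
  refine ⟨c + 1, ?_⟩
  filter_upwards [Filter.eventually_ge_atTop 2] with n hn
  refine ⟨ZMod (2 ^ (k + 1)), inferInstance, inferInstance, hPIR, hnil, hne, (hc n).trans ?_⟩
  -- `n^c + c ≤ n^(c+1)` for `n ≥ 2`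
  have h1 : c ≤ n ^ c := (c.lt_two_pow_self).le.trans (Nat.pow_le_pow_left hn c)
  calc n ^ c + c ≤ n ^ c + n ^ c := by omega
    _ = 2 * n ^ c := by ring
    _ ≤ n * n ^ c := Nat.mul_le_mul_right _ hn
    _ = n ^ (c + 1) := by ring

/-- The same, in the `(s + n + 2)^d` currency of `stub_halfElim`: for every precision `k` there is
`d` with `L_{ℤ/2^(k+1)}(per_n) ≤ (s + n + 2)^d` for ALL `n, s` — the finite-precision shadow of the
stub holds with `d` depending on `k` and without using the hypothesis `L_K(per_n) ≤ s` at all.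
[folklore] -/
theorem halfElim_fixedPrecision (k : ℕ) :
    ∃ d : ℕ, ∀ n s : ℕ, complexity (perPoly (Fin n) (ZMod (2 ^ (k + 1)))) ≤ (s + n + 2) ^ d := by
  obtain ⟨c, hc⟩ := ceilingAllPrecisions_proof (k + 1)
  refine ⟨c + 1, fun n s => (hc n).trans ?_⟩
  have hB : 2 ≤ s + n + 2 := by omega
  have h1 : n ^ c ≤ (s + n + 2) ^ c := Nat.pow_le_pow_left (by omega) c
  have h2 : c ≤ (s + n + 2) ^ c := (c.lt_two_pow_self).le.trans (Nat.pow_le_pow_left hB c)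
  calc n ^ c + c ≤ (s + n + 2) ^ c + (s + n + 2) ^ c := Nat.add_le_add h1 h2
    _ = 2 * (s + n + 2) ^ c := by ring
    _ ≤ (s + n + 2) * (s + n + 2) ^ c := Nat.mul_le_mul_right _ hB
    _ = (s + n + 2) ^ (c + 1) := by ring

end Summit.ValiantsHypothesis.ValiantsHypothesis.Theorems.TwoAdicLadder.TwoIntegralNormalisation

end
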